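import Summits.BirchSwinnertonDyer.Rank1Residual.P2.CongruentNumberThetaStarTowersBSD
import Summits.BirchSwinnertonDyer.Rank1Residual.P2.CongruentNumberPairsAtTwoEvenDoorDescent
import HarnessLib

/-!
# Cell «bsd-monsky» (prover-B): the STAR FAMILY and the 𝒮⁻-TOWERS WITHOUT Monsky's `2`-Selmer display —
# `ord_{s=1} L = 1`, rank `1`, `Ш[2^∞] = 0` and `BSD(E_n, 2)` for `n = 2qp₁⋯p_m` on the star configuration, for every `m`,
# relative to {`tyz_cmPointGaloisData`, TYZ Thm. 1.1, GZK} ONLY (kernel theorem; nothing asserted)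

HONEST FRAMING (cell `bsd-monsky`, run/shared/lean/pub/bsd-monsky/; README §1/§3): the cell's CLAIMED theorem is Monsky's 1990
conjecture (a)+(b) on `𝒮⁻ = {2pq : p ≡ 5 (mod 8), q ≡ 3 (mod 4), (p/q) = −1}` (`k = 2`); «ℓ ≥ 3 rungs are NOT claimed — record what the
same argument gives there, no more». The record for MORE PRIME FACTORS (paper Remark 5.2 / §6 (F7); `P2/CongruentNumberThetaStarBSD.lean`,
`…ThetaStarTowersBSD.lean`) was relative to FOUR named facts {`tyz_cmPointGaloisData`, `thm11_parity_of_scriptL`, GZK,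
`hMe` = Monsky's even `2`-descent matrix theorem `HeathBrown1994.monsky_card_selmerGroup_two_even`}, the last entering only as
`#Sel₂(E_n) = 2^{2+s(n)} = 8 ⟹ Ш[2^∞] = 0` through the uniform even door. The tree now PROVES `#Sel₂(E_{2p₁⋯p_k}) ≤ 2^{2+s}` for
every `k` (`Literature/…/CongruentNumberEvenMonskySelmerBound.lean`, complete `2`-descent on Selmer classes) and the door has a twin
modulo GZK only (`rankOne_sha_bsdp_two_iff_congruentNumberCurve_two_mul_prod_descent`, `P2/CongruentNumberPairsAtTwoEvenDoorDescent.lean`).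
THIS FILE swaps the door in the three theorems of the record: §1 the star family `q ≡ 3 (mod 8)` (`…_star_…_descent`), §2 the towers
`q ≡ 3 (mod 4)` with the mark condition (`…_tower_…_descent`), §3 THE 𝒮⁻-TOWER THEOREM on the Legendre symbols
(`rankOne_sha_bsdp_two_sminus_tower_descent`): for `(p, q) ∈ 𝒮⁻` and distinct primes `p₁, …, p_m ≡ 5 (mod 8)` (any `m ≥ 0`) that are
residues of `q`, of `p` and of each other, `E_{2qpp₁⋯p_m}` has `ord_{s=1} L = 1`, rank `1`, `Ш[2^∞] = 0`, `BSD(E, 2)` — now relative to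
{`tyz_cmPointGaloisData`, `thm11_parity_of_scriptL`, `rank_eq_analyticRank_of_analyticRank_le_one`} ONLY: the three displayed inputs are
the CM/genus-point display, TYZ's Theorem 1.1 and Gross–Zagier–Kolyvagin; NO `2`-Selmer fact is displayed (Monsky 1990 / HB94 / Aoki
are corroboration). The proofs are those of the record files with the door swapped (the rank-one datum `x = 2^{2m}L²`, `L` odd, and
`s(n) = 1` are the record's kernel theorems `exists_odd_isScriptL_tower_of_cmPointGaloisData`, `monskySelmerRankEven_tower`).
CONDITIONAL on the three named facts; nothing asserted; no count moves; no class booked; NOT refereed; not part of PROOF-B v1.3 or of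
the paper's claim.

References: [TianYuanZhang2017] §1 (1.1), Thm. 1.1, Thm. 3.5; [HeathBrown1994SelmerCongruentII] Appendix (Monsky), typescript p. 41
L1–L36 (even case; upper bound a tree theorem); [Monsky1990MockHeegner] p. 67 Remark (3); [SilvermanAEC2009] Prop. X.1.4, X.4.9,
Thm. X.4.2; [IrelandRosen1990] Ch. 5 §1 Prop. 5.1.2–5.1.3, §2 Thm. 2; [Miller2011LMS] Def. 1.1; HOME/proof/PROOF-B-THETA-STAR.md.
-/

noncomputable section

open scoped Classical

open Matrix Finset WeierstrassCurve Literature.NumberTheory.EllipticCurves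
  Literature.NumberTheory.EllipticCurves.Rank1Residual
  Literature.NumberTheory.EllipticCurves.Rank1Residual.Typed
  Literature.NumberTheory.EllipticCurves.HeathBrown1994
  Literature.NumberTheory.EllipticCurves.HeathBrown1994.Families
  Literature.NumberTheory.EllipticCurves.Tian2014
  Literature.NumberTheory.EllipticCurves.TianYuanZhang2017
  Literature.NumberTheory.EllipticCurves.TianYuanZhang2017.W2
  Literature.NumberTheory.QuadraticFields.RedeiReichardt

set_option autoImplicit false

namespace Summit.BirchSwinnertonDyer.Rank1Residual.P2

namespace ThetaDescent

variable {m : ℕ} {q : ℕ} {p : Fin m → ℕ}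

/-! ## §1 The star family `q ≡ 3 (mod 8)`, for every `m`, relative to {display, TYZ Thm. 1.1, GZK} only -/

/-- **`ord_{s=1} L = 1`, rank `1`, `Ш[2^∞] = 0` and `BSD(E_n, 2)` on the star family, for every `m`, WITHOUT a `2`-Selmer display**:
for distinct primes `q ≡ 3 (mod 8)`, `p₁, …, p_m ≡ 5 (mod 8)` with `(pⱼ/pᵢ) = +1` (`i ≠ j`) and `(pᵢ/q) = −1` for at most one `i`,
`n = 2qp₁⋯p_m`: the record's rank-one datum (`ord₂ x = 2m`) and `s(n) = 1` through the GZK-only even door (`#Sel₂ ≤ 8` is the tree's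
`2`-descent theorem). Relative to {`tyz_cmPointGaloisData`, TYZ Thm. 1.1, GZK}; CONDITIONAL; nothing asserted; closes no class; NOT refereed.
[cite: TianYuanZhang2017, §1 (1.1), Thm. 3.5] [cite: HeathBrown1994SelmerCongruentII, Appendix (Monsky), typescript p. 41 L20–L36]
[cite: SilvermanAEC2009, Prop. X.1.4, Prop. X.4.9, Thm. X.4.2] [cite: Miller2011LMS, Def. 1.1 (arXiv:1010.2431 p. 3)] -/
theorem rankOne_sha_bsdp_two_star_of_cmPointGaloisData_descent (hCM : tyz_cmPointGaloisData)
    (hGZK : rank_eq_analyticRank_of_analyticRank_le_one) (h11 : thm11_parity_of_scriptL)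
    (hq : q.Prime) (hq3 : q % 8 = 3) (hp : ∀ i, (p i).Prime) (hp5 : ∀ i, p i % 8 = 5) (hinj : Function.Injective p)
    (hQR : ∀ i j, i ≠ j → jacobiSym (p j) (p i) = 1) (hμ : ∀ i j, jacobiSym (p i) q = -1 → jacobiSym (p j) q = -1 → i = j) :
    (congruentNumberCurve (2 * (q * ∏ i, p i))).analyticRank = 1 ∧
      (congruentNumberCurve (2 * (q * ∏ i, p i))).mordellWeilRank = 1 ∧
      AddCommGroup.primaryComponent (congruentNumberCurve (2 * (q * ∏ i, p i))).sha 2 = ⊥ ∧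
      BSDp (congruentNumberCurve (2 * (q * ∏ i, p i))) 2 := by
  obtain ⟨-, x, hx0, hv, hx⟩ := rankOneDatum_star_of_cmPointGaloisData hCM hGZK h11 hq hq3 hp hp5 hinj hQR hμ
  have hn : 2 * ∏ i, (vecCons q p : Fin (m + 1) → ℕ) i = 2 * (q * ∏ i, p i) := by rw [prod_star_cons]
  obtain ⟨hr1, hrk, hsha, hiff⟩ :=
    rankOne_sha_bsdp_two_iff_congruentNumberCurve_two_mul_prod_descent (vecCons q p : Fin (m + 1) → ℕ) hGZK
      (star_cons_prime hq hp) (star_cons_injective hq3 hp5 hinj) hn (star_mod_eight hq3 hp hp5 hinj)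
      (monskySelmerRankEven_star hq hq3 hp hp5 hQR hμ) hx0 hx
  exact ⟨hr1, hrk, hsha, hiff.mpr hv⟩

/-! ## §2 The towers `q ≡ 3 (mod 4)` with the mark condition, for every `m`, relative to {display, TYZ Thm. 1.1, GZK} only -/

/-- **`ord_{s=1} L = 1`, rank `1`, `Ш[2^∞] = 0` and `BSD(E_n, 2)` on the 𝒮⁻-towers, for every `m`, WITHOUT a `2`-Selmer display**:
`q ≡ 3 (mod 4)`, `p₁, …, p_m ≡ 5 (mod 8)` distinct, `(pⱼ/pᵢ) = +1` (`i ≠ j`), at most one mark `(pᵢ/q) = −1` and at least one unless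
`q ≡ 3 (mod 8)`, `n = 2qp₁⋯p_m`: the record's rank-one datum `x = 2^{2m}L²` (`L` odd) and `s(n) = 1` through the GZK-only even door.
Relative to {`tyz_cmPointGaloisData`, TYZ Thm. 1.1, GZK}; NO per-`n` certificate. CONDITIONAL; nothing asserted; closes no class; NOT refereed.
[cite: TianYuanZhang2017, §1 (1.1), Thm. 3.5] [cite: HeathBrown1994SelmerCongruentII, Appendix (Monsky), typescript p. 41 L20–L36]
[cite: SilvermanAEC2009, Prop. X.1.4, Prop. X.4.9, Thm. X.4.2] [cite: Miller2011LMS, Def. 1.1 (arXiv:1010.2431 p. 3)] -/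
theorem rankOne_sha_bsdp_two_tower_of_cmPointGaloisData_descent (hCM : tyz_cmPointGaloisData)
    (hGZK : rank_eq_analyticRank_of_analyticRank_le_one) (h11 : thm11_parity_of_scriptL)
    (hq : q.Prime) (hq4 : q % 4 = 3) (hp : ∀ i, (p i).Prime) (hp5 : ∀ i, p i % 8 = 5) (hinj : Function.Injective p)
    (hQR : ∀ i j, i ≠ j → jacobiSym (p j) (p i) = 1) (hμ : ∀ i j, jacobiSym (p i) q = -1 → jacobiSym (p j) q = -1 → i = j)
    (hmark : q % 8 = 3 ∨ ∃ a, jacobiSym (p a) q = -1) :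
    (congruentNumberCurve (2 * (q * ∏ i, p i))).analyticRank = 1 ∧
      (congruentNumberCurve (2 * (q * ∏ i, p i))).mordellWeilRank = 1 ∧
      AddCommGroup.primaryComponent (congruentNumberCurve (2 * (q * ∏ i, p i))).sha 2 = ⊥ ∧
      BSDp (congruentNumberCurve (2 * (q * ∏ i, p i))) 2 := by
  obtain ⟨hQR', hμ', hmark'⟩ := tower_bits_of_jacobi hq hq4 hp hp5 hinj hQR hμ hmark
  have hsq := squarefree_star' hq hq4 hp hp5 hinj
  haveI := isElliptic_congruentNumberCurve hsq.ne_zero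
  have hn6 := star_mod_eight' hq4 hp hp5 hinj
  obtain ⟨L, hLodd, hL⟩ := exists_odd_isScriptL_tower_of_cmPointGaloisData hCM hGZK h11 hq hq4 hp hp5 hinj hQR' hμ' hmark'
  have hL0' : L ≠ 0 := fun h => by simp [h] at hLodd
  have hL0 : (L : ℚ) ≠ 0 := by exact_mod_cast hL0'
  have hr1 := analyticRank_congruentNumberCurve_eq_one_of_isScriptL hsq (Or.inr (Or.inl hn6)) hL hL0'
  have he : twoExponent (2 * (q * ∏ i, p i)) = 2 * ((m + 1 : ℕ) : ℤ) - 2 := by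
    rw [← prod_star_cons]
    exact twoExponent_two_mul_prod_eq _ (star_cons_prime hq hp) (star_cons_odd' hq4 hp5) (star_cons_injective' hq4 hp5 hinj)
  have hx : deriv (congruentNumberCurve (2 * (q * ∏ i, p i))).entireLFunction 1 =
      (((2 : ℚ) ^ twoExponent (2 * (q * ∏ i, p i)) * (L : ℚ) ^ 2 : ℚ) : ℂ) *
        ((congruentNumberCurve (2 * (q * ∏ i, p i))).realPeriodRat : ℂ) *
          ((congruentNumberCurve (2 * (q * ∏ i, p i))).regulator : ℂ) := by
    rw [← (leadingLCoeff_eq_deriv_of_analyticRank_eq_one hr1).1,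
      leadingLCoeff_congruentNumberCurve_eq_of_isScriptL (Nat.pos_of_ne_zero hsq.ne_zero) hr1 hL]
    push_cast
    ring
  have hn : 2 * ∏ i, (vecCons q p : Fin (m + 1) → ℕ) i = 2 * (q * ∏ i, p i) := by rw [prod_star_cons]
  obtain ⟨hr1', hrk, hsha, hiff⟩ :=
    rankOne_sha_bsdp_two_iff_congruentNumberCurve_two_mul_prod_descent (vecCons q p : Fin (m + 1) → ℕ) hGZK
      (star_cons_prime hq hp) (star_cons_injective' hq4 hp5 hinj) hn hn6 (monskySelmerRankEven_tower hq hq4 hp hp5 hQR hμ hmark)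
      (mul_ne_zero (zpow_ne_zero _ two_ne_zero) (pow_ne_zero _ hL0)) hx
  exact ⟨hr1', hrk, hsha, hiff.mpr (by rw [padicValRat_two_zpow_mul_sq hLodd, he])⟩

/-! ## §3 THE 𝒮⁻-TOWER THEOREM on the Legendre symbols, relative to {display, TYZ Thm. 1.1, GZK} only -/

/-- **THE 𝒮⁻-TOWER THEOREM WITHOUT A `2`-SELMER DISPLAY (route B, uniform in the number of prime factors).** Let `(p, q)` be a pair
of Monsky's family `𝒮⁻` — primes `p ≡ 5 (mod 8)`, `q ≡ 3 (mod 4)`, `(p/q) = −1` — and `p₁, …, p_m ≡ 5 (mod 8)` (`m ≥ 0`) further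
distinct primes that are quadratic residues of `q`, of `p`, and of each other. Then for `n = 2·q·p·p₁⋯p_m` the congruent number curve
`E_n : y² = x³ − n²x` has `ord_{s=1} L(E_n, s) = 1`, rank `E_n(ℚ) = 1`, `Ш(E_n)[2^∞] = 0`, and the `2`-part of the Birch–Swinnerton-Dyer
formula holds — relative to {`tyz_cmPointGaloisData`, `thm11_parity_of_scriptL`, `rank_eq_analyticRank_of_analyticRank_le_one`} ONLY: the
`2`-Selmer input is the tree's complete `2`-descent (`card_selmerGroup_two_le_pow_monskySelmerRankEven`). (`m = 0`: the cell's
Theorem 1.1 on `𝒮⁻` through route B with `h11` idle; `m ≥ 1`: every tower above it.) CONDITIONAL; nothing asserted; no class booked;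
NOT refereed. [cite: Monsky1990MockHeegner, p. 67 Remark (3)] [cite: TianYuanZhang2017, §1 (1.1), Thm. 1.1, Thm. 3.5]
[cite: HeathBrown1994SelmerCongruentII, Appendix (Monsky), typescript p. 41 L20–L36] [cite: IrelandRosen1990, Ch. 5 §2 Thm. 2]
[cite: SilvermanAEC2009, Prop. X.1.4, Prop. X.4.9, Thm. X.4.2] -/
theorem rankOne_sha_bsdp_two_sminus_tower_descent (hCM : tyz_cmPointGaloisData)
    (hGZK : rank_eq_analyticRank_of_analyticRank_le_one) (h11 : thm11_parity_of_scriptL) :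
    ∀ (m p₀ q : ℕ) (p : Fin m → ℕ), p₀.Prime → q.Prime → p₀ % 8 = 5 → q % 4 = 3 → jacobiSym p₀ q = -1 →
      (∀ i, (p i).Prime) → (∀ i, p i % 8 = 5) → Function.Injective p →
      (∀ i, jacobiSym (p i) q = 1) → (∀ i, jacobiSym (p i) p₀ = 1) → (∀ i j, i ≠ j → jacobiSym (p j) (p i) = 1) →
      (congruentNumberCurve (2 * (q * (p₀ * ∏ i, p i)))).analyticRank = 1 ∧
        (congruentNumberCurve (2 * (q * (p₀ * ∏ i, p i)))).mordellWeilRank = 1 ∧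
        AddCommGroup.primaryComponent (congruentNumberCurve (2 * (q * (p₀ * ∏ i, p i)))).sha 2 = ⊥ ∧
        BSDp (congruentNumberCurve (2 * (q * (p₀ * ∏ i, p i)))) 2 := by
  intro m p₀ q p hp₀ hq h₀ hq4 hmark hp hp5 hinj hq1 hres hQR
  have hprod : p₀ * ∏ i, p i = ∏ i, (vecCons p₀ p : Fin (m + 1) → ℕ) i := by rw [Fin.prod_univ_succ]; simp
  have hne : ∀ i, p i ≠ p₀ := fun i h => by
    have h1 := hres i; rw [h, jacobiSym.mod_left] at h1
    simp [jacobiSym.zero_left hp₀.one_lt] at h1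
  rw [hprod]
  refine rankOne_sha_bsdp_two_tower_of_cmPointGaloisData_descent hCM hGZK h11 hq hq4
    (fun i => Fin.cases (by simpa using hp₀) (fun j => by simpa using hp j) i)
    (fun i => Fin.cases (by simpa using h₀) (fun j => by simpa using hp5 j) i) ?_ ?_ ?_ (Or.inr ⟨0, by simpa using hmark⟩)
  · have h : Function.Injective (Fin.cons p₀ p : Fin (m + 1) → ℕ) := by
      rw [Fin.cons_injective_iff]
      exact ⟨by rintro ⟨i, hi⟩; exact hne i hi, hinj⟩
    exact h
  · intro i j hij
    induction i using Fin.cases with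
    | zero =>
      induction j using Fin.cases with
      | zero => exact absurd rfl hij
      | succ j' => simpa using hres j'
    | succ i' =>
      induction j using Fin.cases with
      | zero =>
        simp only [cons_val_zero, cons_val_succ]
        rw [jacobiSym.quadratic_reciprocity_one_mod_four (by omega : p₀ % 4 = 1)
          ((hp i').odd_of_ne_two (by have := hp5 i'; omega))]
        exact hres i'
      | succ j' =>
        simp only [cons_val_succ]
        exact hQR i' j' fun h => hij (by rw [h])
  · intro i j hi hj
    have h0 : ∀ i' : Fin m, jacobiSym ((vecCons p₀ p : Fin (m + 1) → ℕ) i'.succ) q ≠ -1 := fun i' => by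
      simp only [cons_val_succ]; rw [hq1 i']; decide
    induction i using Fin.cases with
    | zero =>
      induction j using Fin.cases with
      | zero => rfl
      | succ j' => exact absurd hj (h0 j')
    | succ i' => exact absurd hi (h0 i')

end ThetaDescent

end Summit.BirchSwinnertonDyer.Rank1Residual.P2

end
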